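import Summits.NavierStokesRegularity.NavierStokesRegularity.Theorems.FilamentSkeletonRssKelvinGateDefs

/-!
# Route `FilamentSkeletonRss` · crux `TransverseReductionRJ` (stmt-NavierStokesRegularity-21221) — line `kelvin_gate`,
# stub S2 `PolynomialKelvinGate`: the quantitative COKERNEL TEST a Kelvin gate must survive

Helper file (theorems only, `--supports stmt-NavierStokesRegularity-21221 --as helper`), in the vocabulary of
`FilamentSkeletonRssKelvinGateDefs`.  HONEST FRAMING: bookkeeping for a HYPOTHETICAL filament-type RSS blow-up route;
nothing here bears on Navier–Stokes regularity; the stub is neither proved nor refuted here.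

The kill-first risk of stub S2 recorded in the line card (§Rate, "rate rigidity") is a COKERNEL obstruction: if the
linearised profile operator `(W, Q) ↦ 𝓛_(α_p,U⁰_p) W + ∇Q` has an (approximate) cokernel direction not covered by the
accretion modes `D_pj`, no right inverse modulo `span{D_pj}` with a polynomial bound can exist.  This file turns that
sentence into the exact inequality a disprover has to certify and a prover has to rule out:

* `GateSpec.abs_le_of_approxCokernel` — if `ℓ` is ANY real functional on vector fields which (i) splits additively over
  `F + Σ_j b_j D_pj` for Y-bounded `F`, (ii) annihilates the modes, `ℓ(D_pj) = 0`, and (iii) is `ε`-small on the range,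
  `|ℓ(𝓛W + ∇Q)| ≤ ε S` whenever `W` is X-bounded by `S` and `Q ∈ C¹` with `|Q| ≤ S`, then a gate with constants
  `(κ, C₂)` forces `|ℓ(F)| ≤ ε · C₂ Γ^κ · R` for every `F` Y-bounded by `R`;
* `GateSpec.one_le_of_approxCokernel` — hence if such an `ℓ` detects some unit forcing (`ℓ(F₀) = 1`, `YBound F₀ 1`),
  then `1 ≤ ε C₂ Γ^κ`: an approximate cokernel functional with defect `ε < Γ^{-κ}/C₂` REFUTES the gate at `Γ`.
  Since the stub fixes `(κ, C₂)` BEFORE the dressing order `k`, a family of such functionals with super-polynomially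
  small defect (e.g. built from the rotation direction of `FilamentSkeletonRssKelvinGateRotation` at an exact profile,
  if it pairs trivially with every `D_pj`) kills S2; conversely an S2 proof must bound every mode-annihilating
  functional's defect from below polynomially.
-/

set_option linter.dupNamespace false

noncomputable section

namespace Summit.NavierStokesRegularity.NavierStokesRegularity.Theorems.KelvinGate

open Set Function
open Literature.Analysis.FluidPDE
open scoped InnerProductSpace Laplacian ContDiff Topology

/-- **Cokernel test for a Kelvin gate.**  Let the gate spec hold at `p` with constants `(κ, C₂)`, and let `ℓ` be a
real functional on vector fields that splits over `F + Σ_j b_j D_pj` for Y-bounded `F`, annihilates every accretion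
mode `D_pj`, and is `ε`-small on the range of the linearised operator in the gate's scales.  Then
`|ℓ F| ≤ ε · (C₂ Γ^κ R)` for every `F` that is Y-bounded by `R`: apply `ℓ` to the gate's equation
`𝓛(𝓚F) + ∇(𝓠F) = F + Σ_j (𝓑F)_j D_pj`. -/
theorem GateSpec.abs_le_of_approxCokernel {N : ℕ} {Γ κ C₂ : ℝ} {α : (Fin N → ℝ) → ℝ}
    {D : (Fin N → ℝ) → Fin N → EuclideanSpace ℝ (Fin 3) → EuclideanSpace ℝ (Fin 3)}
    {U0 : (Fin N → ℝ) → EuclideanSpace ℝ (Fin 3) → EuclideanSpace ℝ (Fin 3)}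
    {𝓚 : (Fin N → ℝ) → (EuclideanSpace ℝ (Fin 3) → EuclideanSpace ℝ (Fin 3)) → EuclideanSpace ℝ (Fin 3) → EuclideanSpace ℝ (Fin 3)}
    {𝓠 : (Fin N → ℝ) → (EuclideanSpace ℝ (Fin 3) → EuclideanSpace ℝ (Fin 3)) → EuclideanSpace ℝ (Fin 3) → ℝ}
    {𝓑 : (Fin N → ℝ) → (EuclideanSpace ℝ (Fin 3) → EuclideanSpace ℝ (Fin 3)) → Fin N → ℝ}
    (h : GateSpec N Γ κ C₂ α D U0 𝓚 𝓠 𝓑) {p : Fin N → ℝ} (hp : ∀ i, p i ∈ Icc (0:ℝ) 1)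
    (ℓ : (EuclideanSpace ℝ (Fin 3) → EuclideanSpace ℝ (Fin 3)) → ℝ) (ε : ℝ)
    (hsplit : ∀ (F : EuclideanSpace ℝ (Fin 3) → EuclideanSpace ℝ (Fin 3)) (R : ℝ) (b : Fin N → ℝ), YBound F R →
      ℓ (fun y => F y + ∑ j, b j • D p j y) = ℓ F + ∑ j, b j * ℓ (D p j))
    (hmodes : ∀ j, ℓ (D p j) = 0)
    (hrange : ∀ (W : EuclideanSpace ℝ (Fin 3) → EuclideanSpace ℝ (Fin 3)) (Q : EuclideanSpace ℝ (Fin 3) → ℝ) (S : ℝ),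
      XBound W S → ContDiff ℝ 1 Q → (∀ y, |Q y| ≤ S) →
      |ℓ (fun y => lerayLin (α p) (U0 p) W y + gradient Q y)| ≤ ε * S)
    (F : EuclideanSpace ℝ (Fin 3) → EuclideanSpace ℝ (Fin 3)) (R : ℝ) (hF : YBound F R) :
    |ℓ F| ≤ ε * (C₂ * Γ ^ κ * R) := by
  obtain ⟨hX, hQ1, hQ, -, -, heq⟩ := (h p hp).1 F R hF
  have hfun : (fun y => lerayLin (α p) (U0 p) (𝓚 p F) y + gradient (𝓠 p F) y) =
      fun y => F y + ∑ j, 𝓑 p F j • D p j y := funext heq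
  have key := hrange (𝓚 p F) (𝓠 p F) (C₂ * Γ ^ κ * R) hX hQ1 hQ
  rw [hfun, hsplit F R (𝓑 p F) hF] at key
  simpa [hmodes] using key

/-- **A detected unit forcing bounds the gate constant from below.**  Under the hypotheses of
`GateSpec.abs_le_of_approxCokernel`, if the functional `ℓ` takes the value `1` on some forcing `F₀` with `YBound F₀ 1`,
then `1 ≤ ε · C₂ Γ^κ`.  Contrapositive (the disprover's target for stub S2): a mode-annihilating, range-`ε`-small
functional with `ε · C₂ Γ^κ < 1` and a unit detection refutes `GateSpec N Γ κ C₂ …` at this `p`. -/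
theorem GateSpec.one_le_of_approxCokernel {N : ℕ} {Γ κ C₂ : ℝ} {α : (Fin N → ℝ) → ℝ}
    {D : (Fin N → ℝ) → Fin N → EuclideanSpace ℝ (Fin 3) → EuclideanSpace ℝ (Fin 3)}
    {U0 : (Fin N → ℝ) → EuclideanSpace ℝ (Fin 3) → EuclideanSpace ℝ (Fin 3)}
    {𝓚 : (Fin N → ℝ) → (EuclideanSpace ℝ (Fin 3) → EuclideanSpace ℝ (Fin 3)) → EuclideanSpace ℝ (Fin 3) → EuclideanSpace ℝ (Fin 3)}
    {𝓠 : (Fin N → ℝ) → (EuclideanSpace ℝ (Fin 3) → EuclideanSpace ℝ (Fin 3)) → EuclideanSpace ℝ (Fin 3) → ℝ}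
    {𝓑 : (Fin N → ℝ) → (EuclideanSpace ℝ (Fin 3) → EuclideanSpace ℝ (Fin 3)) → Fin N → ℝ}
    (h : GateSpec N Γ κ C₂ α D U0 𝓚 𝓠 𝓑) {p : Fin N → ℝ} (hp : ∀ i, p i ∈ Icc (0:ℝ) 1)
    (ℓ : (EuclideanSpace ℝ (Fin 3) → EuclideanSpace ℝ (Fin 3)) → ℝ) (ε : ℝ)
    (hsplit : ∀ (F : EuclideanSpace ℝ (Fin 3) → EuclideanSpace ℝ (Fin 3)) (R : ℝ) (b : Fin N → ℝ), YBound F R →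
      ℓ (fun y => F y + ∑ j, b j • D p j y) = ℓ F + ∑ j, b j * ℓ (D p j))
    (hmodes : ∀ j, ℓ (D p j) = 0)
    (hrange : ∀ (W : EuclideanSpace ℝ (Fin 3) → EuclideanSpace ℝ (Fin 3)) (Q : EuclideanSpace ℝ (Fin 3) → ℝ) (S : ℝ),
      XBound W S → ContDiff ℝ 1 Q → (∀ y, |Q y| ≤ S) →
      |ℓ (fun y => lerayLin (α p) (U0 p) W y + gradient Q y)| ≤ ε * S)
    (F₀ : EuclideanSpace ℝ (Fin 3) → EuclideanSpace ℝ (Fin 3)) (hF₀ : YBound F₀ 1) (hdet : ℓ F₀ = 1) :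
    1 ≤ ε * (C₂ * Γ ^ κ) := by
  have := h.abs_le_of_approxCokernel hp ℓ ε hsplit hmodes hrange F₀ 1 hF₀
  rw [hdet, abs_one, mul_one] at this
  exact this

/-- **The stub-level form of the cokernel test.**  If `PolynomialKelvinGate` holds then, for every admissible parameter
tuple and size constant `Cs`, there are `κ, C₂` such that for every order `k ≥ 1` and residual constant `Cr`,
eventually in `Γ`, EVERY box datum and EVERY base family of order `k` around it has the property: at each `p` in the
cube, every mode-annihilating functional which is `ε`-small on the range of `𝓛_(α_p,U⁰_p) + ∇` and detects a unit
forcing has `ε C₂ Γ^κ ≥ 1`.  (So S2 is refuted by exhibiting, for each candidate `(κ, C₂)`, such data with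
`ε C₂ Γ^κ < 1` at arbitrarily large `Γ` — the quantitative §Rate programme.) -/
theorem polynomialKelvinGate_cokernel_test (hS2 : PolynomialKelvinGate) :
    ∀ (N : ℕ) (δ ρ K Λ a b cnd η Rw Rb cg θ₀ : ℝ), 0 < N → 0 < δ → 0 < ρ → 0 ≤ a → 0 < η → 0 < Rw → 0 < Rb → 0 < cg → 0 < θ₀ →
    ∀ Cs : ℝ, ∃ κ C₂ : ℝ, ∀ k : ℕ, 1 ≤ k → ∀ Cr : ℝ, ∃ Γ₁ : ℝ, ∀ Γ : ℝ, Γ₁ ≤ Γ → ∀ (γ : (Fin N → ℝ) → Fin N → ℝ) (α : (Fin N → ℝ) → ℝ) (X : (Fin N → ℝ) → Fin N → ℝ → EuclideanSpace ℝ (Fin 3)) (w : (Fin N → ℝ) → Fin N → ℝ → ℝ) (c : (Fin N → ℝ) → Fin N → ℝ) (m : (Fin N → ℝ) → Fin N → EuclideanSpace ℝ (Fin 3)) (n : (Fin N → ℝ) → Fin N → EuclideanSpace ℝ (Fin 3)) (u : (Fin N → ℝ) → (Fin N → ℝ → EuclideanSpace ℝ (Fin 3)) → EuclideanSpace ℝ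 (Fin 3) → EuclideanSpace ℝ (Fin 3)) (v : (Fin N → ℝ) → EuclideanSpace ℝ (Fin 3) → EuclideanSpace ℝ (Fin 3)) (A : (Fin N → ℝ) → Fin N → (EuclideanSpace ℝ (Fin 3) →L[ℝ] EuclideanSpace ℝ (Fin 3))) (T : (Fin N → ℝ) → (Fin N → ℝ → EuclideanSpace ℝ (Fin 3)) → Fin N → ℝ → EuclideanSpace ℝ (Fin 3)) (D : (Fin N → ℝ) → Fin N → EuclideanSpace ℝ (Fin 3) → EuclideanSpace ℝ (Fin 3)),
      DefU N Γ γ u → DefV N α X u v → DefA N X c v A → DefT N α u T → DefD N X c D → BoxClausesJ N Γ δ ρ K Λ a b cnd Rw Rb cg θ₀ γ α X w c m n v A T →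
      ∀ (U0 : (Fin N → ℝ) → EuclideanSpace ℝ (Fin 3) → EuclideanSpace ℝ (Fin 3)) (P0 : (Fin N → ℝ) → EuclideanSpace ℝ (Fin 3) → ℝ) (b0 : (Fin N → ℝ) → Fin N → ℝ), BaseSpec N Γ ρ η Rw k Cs Cr α X u D U0 P0 b0 →
      ∀ p : Fin N → ℝ, (∀ i, p i ∈ Icc (0:ℝ) 1) →
      ∀ (ℓ : (EuclideanSpace ℝ (Fin 3) → EuclideanSpace ℝ (Fin 3)) → ℝ) (ε : ℝ),
      (∀ (F : EuclideanSpace ℝ (Fin 3) → EuclideanSpace ℝ (Fin 3)) (R : ℝ) (b : Fin N → ℝ), YBound F R →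
        ℓ (fun y => F y + ∑ j, b j • D p j y) = ℓ F + ∑ j, b j * ℓ (D p j)) →
      (∀ j, ℓ (D p j) = 0) →
      (∀ (W : EuclideanSpace ℝ (Fin 3) → EuclideanSpace ℝ (Fin 3)) (Q : EuclideanSpace ℝ (Fin 3) → ℝ) (S : ℝ),
        XBound W S → ContDiff ℝ 1 Q → (∀ y, |Q y| ≤ S) →
        |ℓ (fun y => lerayLin (α p) (U0 p) W y + gradient Q y)| ≤ ε * S) →
      ∀ (F₀ : EuclideanSpace ℝ (Fin 3) → EuclideanSpace ℝ (Fin 3)), YBound F₀ 1 → ℓ F₀ = 1 → 1 ≤ ε * (C₂ * Γ ^ κ) := by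
  intro N δ ρ K Λ a b cnd η Rw Rb cg θ₀ hN hδ hρ ha hη hRw hRb hcg hθ₀ Cs
  obtain ⟨κ, C₂, hk⟩ := hS2 N δ ρ K Λ a b cnd η Rw Rb cg θ₀ hN hδ hρ ha hη hRw hRb hcg hθ₀ Cs
  refine ⟨κ, C₂, fun k hk1 Cr => ?_⟩
  obtain ⟨Γ₁, hΓ₁⟩ := hk k hk1 Cr
  refine ⟨Γ₁, fun Γ hΓ γ α X w c m n u v A T D hu hv hA hT hD hbox U0 P0 b0 hbase p hp ℓ ε hsplit hmodes hrange F₀ hF₀ hdet => ?_⟩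
  obtain ⟨𝓚, 𝓠, 𝓑, hgate⟩ := hΓ₁ Γ hΓ γ α X w c m n u v A T D hu hv hA hT hD hbox U0 P0 b0 hbase
  exact hgate.one_le_of_approxCokernel hp ℓ ε hsplit hmodes hrange F₀ hF₀ hdet

/-! ## Approximate mode annihilation (appended) -/

/-- **Cokernel test with APPROXIMATE mode annihilation.**  As `GateSpec.abs_le_of_approxCokernel`, but the
functional need only be `η`-small on the accretion modes, `|ℓ(D_pj)| ≤ η` (a realistic pairing `ℓ = ∫⟨Z, ·⟩` with an
approximate adjoint kernel vector `Z` never annihilates the modes exactly): then for every `F` Y-bounded by `R`,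
`|ℓ F| ≤ (ε + N η) · C₂ Γ^κ R` — the multipliers are bounded by the same gate constant, so each mode costs at most
`η · C₂ Γ^κ R`. -/
theorem GateSpec.abs_le_of_approxCokernel' {N : ℕ} {Γ κ C₂ : ℝ} {α : (Fin N → ℝ) → ℝ}
    {D : (Fin N → ℝ) → Fin N → EuclideanSpace ℝ (Fin 3) → EuclideanSpace ℝ (Fin 3)}
    {U0 : (Fin N → ℝ) → EuclideanSpace ℝ (Fin 3) → EuclideanSpace ℝ (Fin 3)}
    {𝓚 : (Fin N → ℝ) → (EuclideanSpace ℝ (Fin 3) → EuclideanSpace ℝ (Fin 3)) → EuclideanSpace ℝ (Fin 3) → EuclideanSpace ℝ (Fin 3)}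
    {𝓠 : (Fin N → ℝ) → (EuclideanSpace ℝ (Fin 3) → EuclideanSpace ℝ (Fin 3)) → EuclideanSpace ℝ (Fin 3) → ℝ}
    {𝓑 : (Fin N → ℝ) → (EuclideanSpace ℝ (Fin 3) → EuclideanSpace ℝ (Fin 3)) → Fin N → ℝ}
    (h : GateSpec N Γ κ C₂ α D U0 𝓚 𝓠 𝓑) {p : Fin N → ℝ} (hp : ∀ i, p i ∈ Icc (0:ℝ) 1)
    (ℓ : (EuclideanSpace ℝ (Fin 3) → EuclideanSpace ℝ (Fin 3)) → ℝ) (ε η : ℝ)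
    (hsplit : ∀ (F : EuclideanSpace ℝ (Fin 3) → EuclideanSpace ℝ (Fin 3)) (R : ℝ) (b : Fin N → ℝ), YBound F R →
      ℓ (fun y => F y + ∑ j, b j • D p j y) = ℓ F + ∑ j, b j * ℓ (D p j))
    (hmodes : ∀ j, |ℓ (D p j)| ≤ η)
    (hrange : ∀ (W : EuclideanSpace ℝ (Fin 3) → EuclideanSpace ℝ (Fin 3)) (Q : EuclideanSpace ℝ (Fin 3) → ℝ) (S : ℝ),
      XBound W S → ContDiff ℝ 1 Q → (∀ y, |Q y| ≤ S) →
      |ℓ (fun y => lerayLin (α p) (U0 p) W y + gradient Q y)| ≤ ε * S)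
    (F : EuclideanSpace ℝ (Fin 3) → EuclideanSpace ℝ (Fin 3)) (R : ℝ) (hF : YBound F R) :
    |ℓ F| ≤ (ε + N * η) * (C₂ * Γ ^ κ * R) := by
  obtain ⟨hX, hQ1, hQ, hB, -, heq⟩ := (h p hp).1 F R hF
  have hfun : (fun y => lerayLin (α p) (U0 p) (𝓚 p F) y + gradient (𝓠 p F) y) =
      fun y => F y + ∑ j, 𝓑 p F j • D p j y := funext heq
  have key := hrange (𝓚 p F) (𝓠 p F) (C₂ * Γ ^ κ * R) hX hQ1 hQ
  rw [hfun, hsplit F R (𝓑 p F) hF] at key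
  -- `|ℓ F| ≤ |ℓ F + Σ| + |Σ| ≤ ε S + Σ_j |b_j| |ℓ D_j| ≤ ε S + N · S · η`
  have hS0 : 0 ≤ C₂ * Γ ^ κ * R := le_trans (abs_nonneg _) (hQ 0)
  have hsum : |∑ j, 𝓑 p F j * ℓ (D p j)| ≤ N * η * (C₂ * Γ ^ κ * R) := by
    calc |∑ j, 𝓑 p F j * ℓ (D p j)| ≤ ∑ j, |𝓑 p F j * ℓ (D p j)| := Finset.abs_sum_le_sum_abs _ _
      _ ≤ ∑ _j : Fin N, (C₂ * Γ ^ κ * R) * η := Finset.sum_le_sum fun j _ => by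
          rw [abs_mul]; exact mul_le_mul (hB j) (hmodes j) (abs_nonneg _) hS0
      _ = N * η * (C₂ * Γ ^ κ * R) := by
          simp only [Finset.sum_const, Finset.card_univ, Fintype.card_fin, nsmul_eq_mul]; ring
  have htri : |ℓ F| ≤ |ℓ F + ∑ j, 𝓑 p F j * ℓ (D p j)| + |∑ j, 𝓑 p F j * ℓ (D p j)| := by
    have := abs_sub (ℓ F + ∑ j, 𝓑 p F j * ℓ (D p j)) (∑ j, 𝓑 p F j * ℓ (D p j))
    simpa using this
  calc |ℓ F| ≤ ε * (C₂ * Γ ^ κ * R) + N * η * (C₂ * Γ ^ κ * R) := htri.trans (add_le_add key hsum)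
    _ = (ε + N * η) * (C₂ * Γ ^ κ * R) := by ring

end Summit.NavierStokesRegularity.NavierStokesRegularity.Theorems.KelvinGate
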